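import Summits.Ventures.PackingBounds.ThreePointCert.KroneckerEval
import Summits.Ventures.PackingBounds.ThreePointCert.SoundNN

/-!
# Kronecker-substitution validation of sums-of-squares Gram expansions

Framing: lottery ticket; floor = certified bounds/negative ranges. Venture `PackingBounds`
(cell `pub-packcert`), three-point SDP family — kernel-checking infrastructure.

A kernel program validating that a claimed term list `R` IS the sums-of-squares polynomial
`Σ_k (Σ_j (e_{kj} − B) · z_{k+j})²` of integer "column" vectors over a monomial basis `z`
(column `k` aligned with the basis suffix `z_k, z_{k+1}, …`; entries stored offset by `B`), by
comparing the two sides at the Kronecker point `(2^w, 2^{wD}, 2^{wD²})`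
(`ThreePointCert.KroneckerEval`): the right-hand side costs one shifted big-integer addition per
factor entry and one squaring per column in the kernel's GMP arithmetic — no per-pair work, no
polynomial merging (`ThreePointCert.CheckKron` needs ≈ 2–9 ms per PAIR of basis monomials).
Soundness `boxNonneg_of_sosCheckKS`: a successful check gives `SoundNN.BoxNonneg R` (indeed
`R ≥ 0` everywhere), which is exactly what `SoundNN.PolysNN3` / `card_le_of_cert3S2splitNN` consume;
combine with `boxNonneg_smul` / `boxNonneg_append` as before. No statement about certificates
changes; the data of a row changes from factor ROWS to factor COLUMNS.
-/

noncomputable section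

namespace Summit.Ventures.PackingBounds.ThreePointCert

open Literature.Geometry.DiscreteGeometry Literature.Geometry.DiscreteGeometry.PolyCert
open Literature.Geometry.DiscreteGeometry.PolyCert.SPoly

/-! ### Kernel programs (primitive recursors, `Nat`/`Int` operations on literals) -/

/-- Bit position `w · slot_D(m)` of a monomial. -/
def posKS (w D : ℕ) (m : Mono) : ℕ := Nat.mul w (Nat.add m.a (Nat.mul D (Nat.add m.b (Nat.mul D m.c))))

/-- Bit positions of a basis. -/
def posList (w D : ℕ) (z : List Mono) : List ℕ := z.map (posKS w D)

/-- `acc + Σ_j e_j · 2^{p_j}` over the common prefix of entries and positions. -/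
def colP (es : List ℕ) : List ℕ → ℕ → ℕ :=
  es.rec (motive := fun _ => List ℕ → ℕ → ℕ) (fun _ acc => acc)
    (fun e _ ih ps acc => ps.casesOn (motive := fun _ => ℕ) acc
      (fun p ps' => ih ps' (Nat.add acc (Nat.shiftLeft e p))))

/-- `acc + Σ_j 2^{p_j}` over the common prefix of entries and positions. -/
def colX (es : List ℕ) : List ℕ → ℕ → ℕ :=
  es.rec (motive := fun _ => List ℕ → ℕ → ℕ) (fun _ acc => acc)
    (fun _ _ ih ps acc => ps.casesOn (motive := fun _ => ℕ) acc
      (fun p ps' => ih ps' (Nat.add acc (Nat.shiftLeft 1 p))))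

/-- Value of one offset-encoded column at the Kronecker point: `Σ_j (e_j − B) 2^{p_j}`. -/
def colValKS (B : ℕ) (es ps : List ℕ) : ℤ := Int.subNatNat (colP es ps 0) (Nat.mul B (colX es ps 0))

/-- Square of an integer. -/
def sqZ (t : ℤ) : ℤ := Int.mul t t

/-- `Σ_k col_k²` at the Kronecker point, column `k` against the position suffix from `k`. -/
def sosValKS (B : ℕ) (cols : List (List ℕ)) : List ℕ → ℤ :=
  cols.rec (motive := fun _ => List ℕ → ℤ) (fun _ => 0)
    (fun es _ ih ps => Int.add (sqZ (colValKS B es ps)) (ih ps.tail))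

/-- Positive part `Σ_{c > 0} c · 2^{pos}` of a term list at the Kronecker point. -/
def encP (w D : ℕ) (p : SPoly) : ℕ :=
  p.rec (motive := fun _ => ℕ) 0 (fun mc _ acc =>
    Int.rec (motive := fun _ => ℕ) (fun n => Nat.add acc (Nat.shiftLeft n (posKS w D mc.1))) (fun _ => acc) mc.2)

/-- Negative part `Σ_{c < 0} |c| · 2^{pos}` of a term list at the Kronecker point. -/
def encN (w D : ℕ) (p : SPoly) : ℕ :=
  p.rec (motive := fun _ => ℕ) 0 (fun mc _ acc =>
    Int.rec (motive := fun _ => ℕ) (fun _ => acc) (fun n => Nat.add acc (Nat.shiftLeft (Nat.succ n) (posKS w D mc.1))) mc.2)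

/-- All entries `< Dg`. -/
def digitsOK (Dg : ℕ) (es : List ℕ) : Bool :=
  es.rec (motive := fun _ => Bool) true (fun e _ ih => Bool.and (Nat.blt e Dg) ih)

/-- Doubled exponents of the basis monomials are `< D` (so products of two stay in the box). -/
def basisOK (D : ℕ) (z : List Mono) : Bool :=
  z.all fun m => Nat.blt (2 * m.a) D && Nat.blt (2 * m.b) D && Nat.blt (2 * m.c) D

/-- Exponents of a term list are `< D`. -/
def boxOK (D : ℕ) (p : SPoly) : Bool :=
  p.all fun mc => Nat.blt mc.1.a D && Nat.blt mc.1.b D && Nat.blt mc.1.c D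

/-- `Σ_k |col_k|²` where `|col|` is the number of entries. -/
def lenSqSum (cols : List (List ℕ)) : ℕ := (cols.map fun es => es.length * es.length).sum

/-- **The Kronecker-substitution SOS check.** Data: width `w`, base `D`, offset `B`, digit bound `Dg`,
basis `z` with its claimed position list `ps`, offset-encoded columns, claimed expansion `R`. -/
def sosCheckKS (w D B Dg : ℕ) (z : List Mono) (ps : List ℕ) (cols : List (List ℕ)) (R : SPoly) : Bool :=
  basisOK D z && boxOK D R && decide (B ≤ Dg) && cols.all (digitsOK Dg) && decide (posList w D z = ps) &&
    decide (2 * (absSum R + Dg * Dg * lenSqSum cols) < 2 ^ w) &&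
    decide (Int.subNatNat (encP w D R) (encN w D R) = sosValKS B cols ps)

/-! ### Meaning of the programs -/

/-- The column polynomial `Σ_j (e_j − B) · z_j` (zipped over the common prefix). -/
def colPoly (B : ℕ) : List ℕ → List Mono → SPoly
  | e :: es, m :: zs => (m, (e : ℤ) - B) :: colPoly B es zs
  | _, _ => []

/-- The sums-of-squares polynomial `Σ_k col_k²`, column `k` against the basis suffix from `k`. -/
def sosPoly (B : ℕ) : List (List ℕ) → List Mono → SPoly
  | es :: cols, zs => mul (colPoly B es zs) (colPoly B es zs) ++ sosPoly B cols zs.tail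
  | [], _ => []

/-- `Σ_j e_j 2^{p_j}` (zipped). -/
def colPsem : List ℕ → List ℕ → ℕ
  | e :: es, p :: ps => e * 2 ^ p + colPsem es ps
  | _, _ => 0

/-- `Σ_j 2^{p_j}` over the zipped prefix. -/
def colXsem : List ℕ → List ℕ → ℕ
  | _ :: es, p :: ps => 2 ^ p + colXsem es ps
  | _, _ => 0

/-- Accumulator law of `colP`. -/
theorem colP_eq : ∀ (es ps : List ℕ) (acc : ℕ), colP es ps acc = acc + colPsem es ps
  | [], ps, acc => by cases ps <;> rfl
  | e :: es, [], acc => rfl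
  | e :: es, p :: ps, acc => by
    show colP es ps (Nat.add acc (Nat.shiftLeft e p)) = acc + (e * 2 ^ p + colPsem es ps)
    rw [colP_eq es ps]
    show acc + e <<< p + colPsem es ps = _
    rw [Nat.shiftLeft_eq]; ring

/-- Accumulator law of `colX`. -/
theorem colX_eq : ∀ (es ps : List ℕ) (acc : ℕ), colX es ps acc = acc + colXsem es ps
  | [], ps, acc => by cases ps <;> rfl
  | e :: es, [], acc => rfl
  | e :: es, p :: ps, acc => by
    show colX es ps (Nat.add acc (Nat.shiftLeft 1 p)) = acc + (2 ^ p + colXsem es ps)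
    rw [colX_eq es ps]
    show acc + 1 <<< p + colXsem es ps = _
    rw [Nat.shiftLeft_eq]; ring

/-- `posKS` is `w · slot`. -/
theorem posKS_eq (w D : ℕ) (m : Mono) : posKS w D m = w * slot D m := rfl

/-- The column polynomial at the Kronecker point. -/
theorem evalZ_colPoly (w D B : ℕ) : ∀ (es : List ℕ) (zs : List Mono),
    evalZ (colPoly B es zs) (2 ^ w) (2 ^ (w * D)) (2 ^ (w * D * D)) =
      (colPsem es (posList w D zs) : ℤ) - B * colXsem es (posList w D zs)
  | [], zs => by cases zs <;> simp [colPoly, colPsem, colXsem]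
  | e :: es, [] => by simp [colPoly, colPsem, colXsem, posList]
  | e :: es, m :: zs => by
    have ih := evalZ_colPoly w D B es zs
    simp only [posList, List.map_cons] at ih ⊢
    rw [colPoly, evalZ_cons, ih, monoEvalZ_kronecker, colPsem, colXsem, posKS_eq]
    push_cast; ring

/-- The column value program computes the column polynomial at the Kronecker point. -/
theorem colValKS_eq (w D B : ℕ) (es : List ℕ) (zs : List Mono) :
    colValKS B es (posList w D zs) = evalZ (colPoly B es zs) (2 ^ w) (2 ^ (w * D)) (2 ^ (w * D * D)) := by
  rw [evalZ_colPoly, colValKS, colP_eq, colX_eq, Int.subNatNat_eq_coe]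
  simp only [Nat.mul_eq, zero_add]
  push_cast; ring

/-- `posList` of a tail. -/
theorem posList_tail (w D : ℕ) (zs : List Mono) : (posList w D zs).tail = posList w D zs.tail := by
  cases zs <;> rfl

/-- The SOS value program computes the SOS polynomial at the Kronecker point. -/
theorem sosValKS_eq (w D B : ℕ) : ∀ (cols : List (List ℕ)) (zs : List Mono),
    sosValKS B cols (posList w D zs) = evalZ (sosPoly B cols zs) (2 ^ w) (2 ^ (w * D)) (2 ^ (w * D * D))
  | [], zs => by simp [sosValKS, sosPoly]
  | es :: cols, zs => by
    have ih := sosValKS_eq w D B cols zs.tail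
    rw [sosPoly, evalZ_append, evalZ_mul, ← colValKS_eq, ← ih, ← posList_tail]
    rfl

/-- The two part encodings compute the value of a term list at the Kronecker point. -/
theorem enc_eq (w D : ℕ) : ∀ (p : SPoly),
    Int.subNatNat (encP w D p) (encN w D p) = evalZ p (2 ^ w) (2 ^ (w * D)) (2 ^ (w * D * D))
  | [] => by simp [encP, encN]
  | (m, c) :: p => by
    have ih := enc_eq w D p
    rw [Int.subNatNat_eq_coe] at ih ⊢
    rw [evalZ_cons, ← ih, monoEvalZ_kronecker, ← posKS_eq]
    cases c with
    | ofNat n =>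
      show ((Nat.add (encP w D p) (Nat.shiftLeft n (posKS w D m)) : ℕ) : ℤ) - (encN w D p : ℕ) = _
      show ((encP w D p + n <<< posKS w D m : ℕ) : ℤ) - (encN w D p : ℕ) = _
      rw [Nat.shiftLeft_eq]; simp only [Int.ofNat_eq_natCast]; push_cast; ring
    | negSucc n =>
      show ((encP w D p : ℕ) : ℤ) - (Nat.add (encN w D p) (Nat.shiftLeft (Nat.succ n) (posKS w D m)) : ℕ) = _
      show ((encP w D p : ℕ) : ℤ) - (encN w D p + (n + 1) <<< posKS w D m : ℕ) = _
      rw [Nat.shiftLeft_eq, Int.negSucc_eq]; push_cast; ring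

/-! ### Nonnegativity, coefficient and exponent bounds of the SOS polynomial -/

/-- The SOS polynomial is a sum of squares. -/
theorem eval_sosPoly_nonneg (B : ℕ) : ∀ (cols : List (List ℕ)) (zs : List Mono) (u v t : ℝ),
    0 ≤ eval (sosPoly B cols zs) u v t
  | [], zs, u, v, t => by simp [sosPoly]
  | es :: cols, zs, u, v, t => by
    rw [sosPoly, eval_append, eval_mul]
    exact add_nonneg (mul_self_nonneg _) (eval_sosPoly_nonneg B cols zs.tail u v t)

/-- `absSum` is additive. -/
theorem absSum_append (p q : SPoly) : absSum (p ++ q) = absSum p + absSum q := by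
  simp [absSum, List.sum_append]

/-- `absSum (neg p) = absSum p`. -/
theorem absSum_neg (p : SPoly) : absSum (neg p) = absSum p := by
  induction p with
  | nil => rfl
  | cons mc p ih =>
    simp only [neg, smul, List.map_cons, absSum, List.sum_cons, Int.natAbs_mul, Int.natAbs_neg,
      Int.natAbs_one, one_mul] at ih ⊢
    rw [ih]

/-- `absSum (mulMono m c q) = |c| · absSum q`. -/
theorem absSum_mulMono (m : Mono) (c : ℤ) (q : SPoly) : absSum (mulMono m c q) = c.natAbs * absSum q := by
  induction q with
  | nil => simp [mulMono, absSum]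
  | cons nc q ih =>
    simp only [mulMono, List.map_cons, absSum, List.sum_cons, Int.natAbs_mul] at ih ⊢
    rw [ih]; ring

/-- `absSum (mul p q) ≤ absSum p · absSum q` (in fact equality). -/
theorem absSum_mul (p q : SPoly) : absSum (mul p q) = absSum p * absSum q := by
  induction p with
  | nil => simp [mul, absSum]
  | cons mc p ih =>
    simp only [mul, List.flatMap_cons] at ih ⊢
    rw [absSum_append, absSum_mulMono, ih]
    simp only [absSum, List.map_cons, List.sum_cons]; ring

/-- Coefficient bound of a column: `absSum ≤ |es| · Dg` when the digits are `< Dg` and `B ≤ Dg`. -/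
theorem absSum_colPoly (B Dg : ℕ) (hB : B ≤ Dg) : ∀ (es : List ℕ) (zs : List Mono),
    digitsOK Dg es = true → absSum (colPoly B es zs) ≤ es.length * Dg
  | [], zs, _ => by cases zs <;> simp [colPoly, absSum]
  | e :: es, [], _ => by simp [colPoly, absSum]
  | e :: es, m :: zs, h => by
    have h' : e < Dg ∧ digitsOK Dg es = true := by
      have : (Nat.blt e Dg && digitsOK Dg es) = true := h
      simpa [Nat.blt_eq] using this
    have ih := absSum_colPoly B Dg hB es zs h'.2
    simp only [colPoly, absSum, List.map_cons, List.sum_cons, List.length_cons] at ih ⊢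
    have h1 : ((e : ℤ) - B).natAbs ≤ Dg := by omega
    nlinarith

/-- Coefficient bound of the SOS polynomial. -/
theorem absSum_sosPoly (B Dg : ℕ) (hB : B ≤ Dg) : ∀ (cols : List (List ℕ)) (zs : List Mono),
    cols.all (digitsOK Dg) = true → absSum (sosPoly B cols zs) ≤ Dg * Dg * lenSqSum cols
  | [], zs, _ => by simp [sosPoly, absSum]
  | es :: cols, zs, h => by
    rw [List.all_cons, Bool.and_eq_true] at h
    have h1 := absSum_colPoly B Dg hB es zs h.1
    have ih := absSum_sosPoly B Dg hB cols zs.tail h.2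
    rw [sosPoly, absSum_append, absSum_mul]
    simp only [lenSqSum, List.map_cons, List.sum_cons] at ih ⊢
    nlinarith [Nat.zero_le (absSum (colPoly B es zs))]

/-- Monomials of a column lie in the basis. -/
theorem mem_colPoly (B : ℕ) : ∀ (es : List ℕ) (zs : List Mono) (mc : Mono × ℤ),
    mc ∈ colPoly B es zs → mc.1 ∈ zs
  | [], zs, mc, h => by cases zs <;> simp [colPoly] at h
  | e :: es, [], mc, h => by simp [colPoly] at h
  | e :: es, m :: zs, mc, h => by
    simp only [colPoly, List.mem_cons] at h ⊢
    rcases h with rfl | h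
    · exact Or.inl rfl
    · exact Or.inr (mem_colPoly B es zs mc h)

/-- Monomials of a product are products of monomials. -/
theorem mem_mul (p q : SPoly) (mc : Mono × ℤ) (h : mc ∈ mul p q) :
    ∃ a ∈ p, ∃ b ∈ q, mc.1 = a.1.mul b.1 := by
  simp only [mul, List.mem_flatMap, mulMono, List.mem_map] at h
  obtain ⟨a, ha, b, hb, rfl⟩ := h
  exact ⟨a, ha, b, hb, rfl⟩

/-- Unpacked `basisOK`. -/
theorem basisOK_spec (D : ℕ) (zs : List Mono) (h : basisOK D zs = true) (m : Mono) (hm : m ∈ zs) :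
    2 * m.a < D ∧ 2 * m.b < D ∧ 2 * m.c < D := by
  simp only [basisOK, List.all_eq_true, Bool.and_eq_true, Nat.blt_eq] at h
  exact ⟨(h m hm).1.1, (h m hm).1.2, (h m hm).2⟩

/-- `basisOK` passes to the tail. -/
theorem basisOK_tail (D : ℕ) (zs : List Mono) (h : basisOK D zs = true) : basisOK D zs.tail = true := by
  cases zs with
  | nil => exact h
  | cons m zs => simp only [basisOK, List.all_cons, Bool.and_eq_true] at h ⊢; exact h.2

/-- Exponents of the SOS polynomial stay in the box. -/
theorem inBox_sosPoly (B D : ℕ) : ∀ (cols : List (List ℕ)) (zs : List Mono), basisOK D zs = true →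
    ∀ mc ∈ sosPoly B cols zs, mc.1.a < D ∧ mc.1.b < D ∧ mc.1.c < D
  | [], zs, _, mc, h => by simp [sosPoly] at h
  | es :: cols, zs, hz, mc, h => by
    rw [sosPoly, List.mem_append] at h
    rcases h with h | h
    · obtain ⟨a, ha, b, hb, e⟩ := mem_mul _ _ mc h
      have h1 := basisOK_spec D zs hz a.1 (mem_colPoly B es zs a ha)
      have h2 := basisOK_spec D zs hz b.1 (mem_colPoly B es zs b hb)
      rw [e]; simp only [Mono.mul]; omega
    · exact inBox_sosPoly B D cols zs.tail (basisOK_tail D zs hz) mc h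

/-- Unpacked `boxOK` (also for `neg`). -/
theorem inBox_neg (D : ℕ) (R : SPoly) (h : boxOK D R = true) :
    ∀ mc ∈ neg R, mc.1.a < D ∧ mc.1.b < D ∧ mc.1.c < D := by
  intro mc hmc
  simp only [neg, smul, List.mem_map] at hmc
  obtain ⟨a, ha, rfl⟩ := hmc
  simp only [boxOK, List.all_eq_true, Bool.and_eq_true, Nat.blt_eq] at h
  exact ⟨(h a ha).1.1, (h a ha).1.2, (h a ha).2⟩

/-! ### Soundness -/

/-- **Soundness of the Kronecker-substitution SOS check**: the claimed expansion equals the sums of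
squares `Σ_k col_k²` as a function, hence is nonnegative everywhere. -/
theorem eval_eq_sos_of_sosCheckKS (w D B Dg : ℕ) (z : List Mono) (ps : List ℕ) (cols : List (List ℕ))
    (R : SPoly) (h : sosCheckKS w D B Dg z ps cols R = true) (u v t : ℝ) :
    eval R u v t = eval (sosPoly B cols z) u v t := by
  unfold sosCheckKS at h
  simp only [Bool.and_eq_true, decide_eq_true_eq] at h
  obtain ⟨⟨⟨⟨⟨⟨hz, hR⟩, hB⟩, hdig⟩, hps⟩, hw⟩, hval⟩ := h
  subst hps
  rw [enc_eq, sosValKS_eq] at hval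
  have hQ := eval_eq_zero_of_kronecker w D (sosPoly B cols z ++ neg R)
    (fun mc hmc => by
      rcases List.mem_append.1 hmc with h | h
      · exact inBox_sosPoly B D cols z hz mc h
      · exact inBox_neg D R hR mc h)
    (by
      rw [absSum_append, absSum_neg]
      have := absSum_sosPoly B Dg hB cols z hdig
      omega)
    (by rw [evalZ_append, evalZ_neg, ← hval]; ring) u v t
  rw [eval_append, eval_neg] at hQ
  linarith

/-- **Box-nonnegativity from the Kronecker-substitution SOS check** — the form consumed by
`SoundNN.PolysNN3` (scale with `boxNonneg_smul`, concatenate blocks with `boxNonneg_append`). -/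
theorem boxNonneg_of_sosCheckKS (w D B Dg : ℕ) (z : List Mono) (ps : List ℕ) (cols : List (List ℕ))
    (R : SPoly) (h : sosCheckKS w D B Dg z ps cols R = true) : BoxNonneg R :=
  fun u v t _ _ _ => by
    rw [eval_eq_sos_of_sosCheckKS w D B Dg z ps cols R h]; exact eval_sosPoly_nonneg B cols z u v t

end Summit.Ventures.PackingBounds.ThreePointCert

end
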